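import Summits.HodgeConjecture.HodgeConjecture.Theorems.Ring2HabitatWeilComponentsRefereedFourfolds
import Summits.HodgeConjecture.HodgeConjecture.Theorems.PadicSemiregularLiftHodgeAbelianVarietiesStubWeilSectorOffReach
import Literature.AlgebraicGeometry.HodgeTheory.AbelianLowDimensionWeilReduction
import Literature.AlgebraicGeometry.HodgeTheory.ComplexConjugationHolds
import HarnessLib

/-!
# Ring 2, sub-cell `AbelianAll` (seat ab-weil-1): the Weil FLOOR of "HC for every abelian variety of dimension ≤ 5" —
# refereed named facts plus ONE residual hypothesis, assembled BY NAME

research route, not a corollary; conditional on HC_CM plus one named minimal statement.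
(Cell line: research route conditional on HC_CM; not a corollary; Q11.4-sentence-2 already refuted in dim ≥ 3.)

This file contains NO new mathematics and asserts nothing: it is the kernel form of row R1 of the atlas pass
`pub-hodge-ring2-ab-weil-1/WEIL1-ATLAS-PASS.md` §C. The tree already proves

* every fourfold Weil component `(2, 1, δ)` from Koike's refereed `ℚ(i)` sixfold fact alone
  (`Ring2.Habitat.weilClassesComponent_two_one_of_koike2004`), every `(2, 3, δ)` from Schoen's refereed `ℚ(√-3)`
  sixfold fact alone (`…_two_three_of_schoen1998`) — both through the PROVED Schoen descent — and every split
  component `(2, d, [1])` from Markman's refereed JEMS 2023 Thm 1.5 (= 13.4; pre-v4 arXiv: Thm 1.3) granted Landherr's criterion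
  (`Ring2.Hypotheses.weilClassesComponent_split_two_of_markman2023`);
* that the conjunction over `d` of `WeilAlgebraicAll 2 d` IS Markman's (unrefereed) fourfold statement
  (`weilAlgebraicAll_two_iff_markman`), and that this statement gives the Hodge conjecture for every abelian
  variety of dimension `≤ 5` through the refereed Moonen–Zarhin reduction
  (`MoonenZarhin1999_hodgeClasses_abelian_dim_le_five_of_weilClassesFourfolds`, `hodgeConjectureFor_abelian_of_dim_le_five_of`).

Gluing these, the ONLY input of "HC in dimension `≤ 5`" that is neither a refereed named fact nor a typed
van Geemen / Landherr obligation is the RESIDUAL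

  `WeilFourfoldResidual` := the components `(2, d, δ)` with `d ∉ {1, 3}` and `δ ≠ [1]` (non-norm discriminant),

i.e. the Weil classes of the general polarized Weil fourfold with `K = ℚ(√-d)`, `d ∉ {1,3}`, of non-split
discriminant — closed in print only by Markman's 2025 preprint (Cor. 1.6.1), open in refereed print. (The residual
is slightly LARGER than necessary: `d = 4, 12, …` give the fields `ℚ(i)`, `ℚ(√-3)` again; the isogeny transport
`d ↦ d·m²` is not threaded here, so those `d` sit inside the hypothesis although print covers them.)
`HC_CM` does not occur. Nothing is claimed to be minimal. [cite: MoonenZarhin1999LowDim, Thm. 0.1, 0.2]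
[cite: Markman2023GeneralizedKummers, Thm. 1.5] [cite: Schoen1998HodgeWeilAddendum, Thm. p. 329 and §10]
[cite: Koike2004WeilHodge, Thm. 2.1, Cor. 2.1, Rem. 2.1] [cite: vanGeemen1994HodgeAV, Lemma 5.2, 5.4]
-/

noncomputable section

set_option linter.dupNamespace false

open CategoryTheory
open Literature.AlgebraicGeometry Literature.AlgebraicGeometry.Motives
open Literature.AlgebraicGeometry.HodgeTheory
open Literature.AlgebraicTopology.SingularHomology
open Literature.AlgebraicGeometry.VanGeemen1994
open Summit.HodgeConjecture.HodgeConjecture.Ring2.Hypotheses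
open Summit.HodgeConjecture.HodgeConjecture.Ring2.Habitat
open Summit.HodgeConjecture.HodgeConjecture.Cruxes.HodgeAbelianVarieties.EStepSecantInduction
open Summit.HodgeConjecture.HodgeConjecture.Cruxes.HodgeAbelianVarieties.PrymCanonicalZ3SplitSeeds.Stubs.WeilSectorOffReach

namespace Summit.HodgeConjecture.HodgeConjecture.Ring2.AbelianAll

/-- **The residual of the Weil-fourfold row (atlas pass R1).** Weil classes are algebraic on every member of every
fourfold component `(2, d, δ)` with `d ∉ {1, 3}` and `δ` not the split class `[1]`: the part of Markman's fourfold
statement that no refereed source and no kernel theorem covers. A HYPOTHESIS; never asserted.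
[cite: Markman2025SurveySecant, Cor. 1.6.1 (preprint, unrefereed)] [status: open] -/
@[conjecture] def WeilFourfoldResidual : Prop :=
  ∀ d : ℕ, 0 < d → d ≠ 1 → d ≠ 3 → ∀ δ : weilNormResidueGroup d, δ ≠ splitDiscriminantClass 2 d →
    WeilClassesComponent 2 d δ

/-- Markman's full fourfold statement implies the residual (the residual is a sub-family of cells). [folklore] -/
theorem weilFourfoldResidual_of_markmanFourfolds (hM : Markman2025_weilClasses_algebraic_abelianFourfold) :
    WeilFourfoldResidual :=
  fun _d hd _ _ δ _ ↦ weilClassesComponent_two_of_markmanFourfolds hM hd δ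

/-- **Every fourfold component `(2, d, δ)`, `d ≥ 1`**, from: Koike 2004 (`d = 1`, refereed), Schoen 1998 (`d = 3`,
refereed), Markman 2023 + Landherr (`δ` split, refereed + typed obligation), and the residual hypothesis otherwise.
[cite: Koike2004WeilHodge, Rem. 2.1] [cite: Schoen1998HodgeWeilAddendum, §10] [cite: Markman2023GeneralizedKummers, Thm. 1.5] -/
theorem weilClassesComponent_two_of_refereed_and_residual
    (hK : Koike2004_weilClasses_algebraic_hyperbolicSixfold_one)
    (hS : Schoen1998_weilClasses_algebraic_hyperbolicSixfold_three)
    (hL : LandherrSplitCriterion) (hM23 : Markman2023_weilClasses_algebraic_discOneWeilFourfold)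
    (hR : WeilFourfoldResidual) {d : ℕ} (hd : 0 < d) (δ : weilNormResidueGroup d) :
    WeilClassesComponent 2 d δ := by
  by_cases h1 : d = 1
  · subst h1; exact weilClassesComponent_two_one_of_koike2004 hK δ
  by_cases h3 : d = 3
  · subst h3; exact weilClassesComponent_two_three_of_schoen1998 hS δ
  by_cases hs : δ = splitDiscriminantClass 2 d
  · subst hs; exact weilClassesComponent_split_two_of_markman2023 hL hM23 hd
  · exact hR d hd h1 h3 δ hs

/-- **Components ⇒ the unpolarized slice `WeilAlgebraicAll 2 d`**, granted van Geemen's Lemma 5.2 (every Weil-type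
pair carrying a non-zero rational `(2,2)` Weil class has SOME compatible polarization with a non-degenerate
discriminant class; typed obligation `PolarizedWeilDiscriminantExists`). [cite: vanGeemen1994HodgeAV, Lemma 5.2 (1)–(3)] -/
theorem weilAlgebraicAll_two_of_components (hE : PolarizedWeilDiscriminantExists) {d : ℕ} (hd : 0 < d)
    (h : ∀ δ : weilNormResidueGroup d, WeilClassesComponent 2 d δ) : WeilAlgebraicAll 2 d := by
  intro A φ hA hφ c hw hcQ hcH
  by_cases hc0 : c = 0
  · rw [hc0]; exact Submodule.zero_mem _
  have hX : IsSmoothProjective (2 * 2) A.X := isSmoothProjective_of_dim_eq' hA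
  obtain ⟨e, a, δ, haQ, ha0, hδ⟩ := hE 2 d (by omega) hd A φ hA hX hφ ⟨c, hw, hcQ, hcH, hc0⟩
  exact h δ A φ hA hX hφ e a haQ ha0 hδ c hcQ hcH hw

/-- **Markman's fourfold STATEMENT from refereed facts + the two typed van Geemen/Landherr obligations + the
residual** (so the statement's unrefereed content is exactly `WeilFourfoldResidual`).
[cite: Markman2025SurveySecant, Thm. 1.2 (statement only; preprint)] -/
theorem markmanFourfolds_of_refereed_and_residual
    (hK : Koike2004_weilClasses_algebraic_hyperbolicSixfold_one)
    (hS : Schoen1998_weilClasses_algebraic_hyperbolicSixfold_three)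
    (hL : LandherrSplitCriterion) (hM23 : Markman2023_weilClasses_algebraic_discOneWeilFourfold)
    (hE : PolarizedWeilDiscriminantExists) (hR : WeilFourfoldResidual) :
    Markman2025_weilClasses_algebraic_abelianFourfold :=
  weilAlgebraicAll_two_iff_markman.1 fun _d hd ↦
    weilAlgebraicAll_two_of_components hE hd (weilClassesComponent_two_of_refereed_and_residual hK hS hL hM23 hR hd)

/-- **THE WEIL FLOOR: the Hodge conjecture for every complex abelian variety of dimension `≤ 5`** from the refereed
named facts (Moonen–Zarhin 1999 reduction, Koike 2004, Schoen 1998, Markman 2023), the typed van Geemen 5.2 /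
Landherr obligations, and the single residual hypothesis `WeilFourfoldResidual`. `HC_CM` absent; no minimality
claimed. [cite: MoonenZarhin1999LowDim, Thm. 0.1, 0.2 and (2.7)] [cite: Markman2023GeneralizedKummers, Thm. 1.5]
[cite: Schoen1998HodgeWeilAddendum, §10] [cite: Koike2004WeilHodge, Rem. 2.1] -/
theorem hodgeConjectureFor_abelian_dim_le_five_of_refereed_and_residual
    (hred : MoonenZarhin1999_hodgeClasses_abelian_dim_le_five_of_weilClassesFourfolds)
    (hK : Koike2004_weilClasses_algebraic_hyperbolicSixfold_one)
    (hS : Schoen1998_weilClasses_algebraic_hyperbolicSixfold_three)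
    (hL : LandherrSplitCriterion) (hM23 : Markman2023_weilClasses_algebraic_discOneWeilFourfold)
    (hE : PolarizedWeilDiscriminantExists) (hR : WeilFourfoldResidual)
    (A : AbelianVariety ℂ) (hA : A.dim ≤ 5) : HodgeConjectureFor A.dim A.X :=
  hodgeConjectureFor_abelian_of_dim_le_five_of (hred (markmanFourfolds_of_refereed_and_residual hK hS hL hM23 hE hR))
    A nonempty_hodgeModel_holds hA AbelianVariety.isSmoothProjective_holds

/-- **Sixfold form of the residual.** By the PROVED Schoen descent, the residual is implied by the split-SIXFOLD Weil
classes for the same fields: for each `d ∉ {1,3}`, the `d`-slice of Markman's hyperbolic-sixfold statement gives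
every `(2, d, δ)` (`Ring2.Habitat.weilAlgebraicAll_two_of_floorSlice`). This is target T1 of
`pub-hodge-ring2-ab-weil-1/OPEN-CELLS-FOR-WEIL2.md`. [cite: Schoen1998HodgeWeilAddendum, §10 (Proposition)] -/
theorem weilFourfoldResidual_of_markmanSixfolds (hM : Markman2025_weilClasses_algebraic_hyperbolicSixfold) :
    WeilFourfoldResidual :=
  fun _d hd _ _ δ _ ↦ weilClassesComponent_two_of_markmanSixfolds hM hd δ

/-- Upper bound: the residual is an instance of the Hodge conjecture (through the on-path fourfold statement).
[cite: Deligne2000, §1] -/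
theorem weilFourfoldResidual_of_hodgeConjecture (h : _root_.HodgeConjecture) : WeilFourfoldResidual :=
  fun d _ _ _ δ _ ↦ weilClassesComponent_of_hodgeConjecture h 2 d δ

end Summit.HodgeConjecture.HodgeConjecture.Ring2.AbelianAll

end
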